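import Literature.Geometry.Riemannian.CutLocusGeodesic
import HarnessLib

/-!
# Two minimizing geodesics force a cut point; multiplicity `≥ 2` points are cut points

Topic `Geometry/Riemannian`; fifth support file of the programme towards the named fact
`Literature.Geometry.Riemannian.buchner1977_cutLocus_triangulable` of `CutLocus.lean`
(M. A. Buchner, *Simplicial structure of the real analytic cut locus*, Proc. AMS 64 (1977)
118–121). Buchner, p. 118, uses the classical characterisation of the cut locus ([6] = Buchner,
*Stability of the cut locus*): "`x ∈ C(p)` if and only if `x` is the first conjugate point on a
length minimizing geodesic starting at `p` and going through `x`, or there are at least two length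
minimizing geodesics from `p` to `x`". This file proves the half of the "if" direction that needs
no conjugate-point theory — **two distinct minimizing geodesic segments from `p` to `q` make `q` a
cut point of `p`** (`expMap_mem_cutLocus_of_ne`, via `mem_tangentCutLocus_of_ne`) — for a smooth
Riemannian metric with geodesically complete Levi-Civita connection on a connected Hausdorff
manifold without boundary, and translates it into the midpoint vocabulary of `CutLocus.lean`:
**a point of minimal-geodesic multiplicity `≥ 2` is a cut point**
(`mem_cutLocus_of_two_le_minimalGeodesicMultiplicity_of_isGeodesicallyComplete`; the version for
complete = proper-balls `C^∞` manifolds — clause (2) of the named fact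
`cutLocus_isClosed_and_mem_of_two_le` — is `mem_cutLocus_of_two_le_minimalGeodesicMultiplicity` of
`CutLocusMultiplicity.lean`, proved independently through "metric segments are geodesics"; the
route here is through the exponential map and corner cutting).

## Contents (all proved; no definitions, no named facts — D-0026)

* `edist_expMap_neg_smul_expMap_smul_lt` — **strict triangle inequality at a corner**: for
  `g_y`-unit vectors `a ≠ b` and `A, B > 0`, `d(exp_y(-A a), exp_y(B b)) < A + B` (corner cutting
  `exists_edist_riemannianExpMap_neg_smul_lt` near `y` plus the lengths of the two geodesic legs).
* `exists_isMinimizingUpTo_of_edist_eq_add` — **prolongation**: if `γ_v|[0,1]` is minimizing,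
  `v ≠ 0`, `q = exp_p v` and `d(p,r) = d(p,q) + d(q,r)`, then `r = γ_v(s)` for some `s ≥ 1` with
  `γ_v|[0,s]` minimizing (a minimizing segment from `q` to `r` must continue `γ_v`, else the corner
  at `q` could be cut).
* `mem_tangentCutLocus_of_ne`, `expMap_mem_cutLocus_of_ne` — two distinct minimizing
  `γ_v|[0,1]`, `γ_w|[0,1]` with `exp_p v = exp_p w` give `v ∈ TCL(p)` and `exp_p v ∈ cutLocus p`
  (Lee 2018, Prop. 10.32 (a)/(b) with Thm. 10.34 (c); Chavel 2006, §III.2).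
* `exists_isMinimizingUpTo_of_midpoint` — a midpoint `m` of `p ≠ q` (`d(p,m) = d(m,q)`,
  `d(p,m) + d(m,q) = d(p,q)`) lies on a minimizing `γ_v|[0,1]` from `p` to `q` with
  `exp_p(v/2) = m` (Hopf–Rinow to `m`, then prolongation).
* `mem_cutLocus_of_two_le_minimalGeodesicMultiplicity_of_isGeodesicallyComplete`
  (+ `_of_compactSpace`) — `2 ≤ minimalGeodesicMultiplicity g hg p q → q ∈ cutLocus g hg p`.

## References

* [Buchner1977Simplicial] M. A. Buchner, Proc. AMS 64 (1977), p. 118.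
* [LeeRiemannianManifolds2018] J. M. Lee, Introduction to Riemannian Manifolds, 2nd ed. (2018),
  Prop. 10.32, Thm. 10.34; Lemma 6.18 (corner cutting, p. 168).
* [Chavel2006] I. Chavel, Riemannian geometry: a modern introduction, 2nd ed. (2006), §III.2.
* [Bishop1977] R. L. Bishop, Decomposition of cut loci, Proc. AMS 65 (1977), p. 133.
-/

noncomputable section

open Bundle Set Filter Manifold
open scoped Manifold ContDiff Topology ENNReal NNReal

namespace Literature.Geometry.Riemannian

open Literature.Geometry.Lorentzian
open Literature.Geometry.Lorentzian.PseudoRiemannianMetric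

section Complete

variable {E : Type*} [NormedAddCommGroup E] [NormedSpace ℝ E] {H : Type*} [TopologicalSpace H]
  {I : ModelWithCorners ℝ E H} {M : Type*} [TopologicalSpace M] [ChartedSpace H M]
  [IsManifold I ∞ M] {n : ℕ∞ω} [FiniteDimensional ℝ E] [CompleteSpace E] [T2Space M]
  [BoundarylessManifold I M]
  {g : PseudoRiemannianMetric I n E (TangentSpace I : M → Type _)} [g.HasLeviCivita]
  [CovariantDerivative.ContMDiffCovariantDerivative g.leviCivita 1]

/-! ### The strict triangle inequality at a corner -/

/-- **Strict triangle inequality at a corner.** For a smooth Riemannian metric with complete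
Levi-Civita connection, `g_y`-unit vectors `a ≠ b` at `y` and `A, B > 0`:
`d(exp_y(-A a), exp_y(B b)) < A + B`. Proof: for small `t > 0` corner cutting gives
`d(exp_y(-t a), exp_y(t b)) < 2t` (`exists_edist_riemannianExpMap_neg_smul_lt`), while the legs
`γ_a|[-A,-t]`, `γ_b|[t,B]` have lengths `A - t`, `B - t` (`edist_maximalGeodesic_le`).
(Lee 2018, p. 168: a broken geodesic with a genuine corner can be shortened.)
[cite: LeeRiemannianManifolds2018, Lemma 6.18 (proof, p. 168)] -/
theorem edist_expMap_neg_smul_expMap_smul_lt (hn : (∞ : ℕ∞ω) ≤ n) (hg : g.IsRiemannian)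
    (hc : IsGeodesicallyComplete g.leviCivita) (y : M) {a b : TangentSpace I y}
    (ha : g.val y a a = 1) (hb : g.val y b b = 1) (hab : a ≠ b) {A B : ℝ} (hA : 0 < A)
    (hB : 0 < B) :
    g.edist hg (riemannianExpMap g y ((-A) • a)) (riemannianExpMap g y (B • b)) <
      ENNReal.ofReal (A + B) := by
  haveI := fact_one_le_of_infty_le hn
  obtain ⟨s₀, hs₀, hcut⟩ :=
    exists_edist_riemannianExpMap_neg_smul_lt (g := g) hn hg y a b ha hb hab
  obtain ⟨t, ht⟩ : ∃ t : ℝ, t = min (s₀ / 2) (min A B) := ⟨_, rfl⟩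
  have ht0 : 0 < t := by
    rw [ht]
    exact lt_min (by positivity) (lt_min hA hB)
  have hts₀ : t < s₀ := by
    rw [ht]
    exact (min_le_left _ _).trans_lt (by linarith)
  have htA : t ≤ A := by
    rw [ht]
    exact (min_le_right _ _).trans (min_le_left _ _)
  have htB : t ≤ B := by
    rw [ht]
    exact (min_le_right _ _).trans (min_le_right _ _)
  have hmid := hcut t ht0 hts₀
  have h1 : g.edist hg (riemannianExpMap g y ((-A) • a)) (riemannianExpMap g y ((-t) • a)) ≤
      ENNReal.ofReal (A - t) := by
    rw [riemannianExpMap_eq, expMap_smul hc, expMap_smul hc]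
    have h := edist_maximalGeodesic_le hg hc y ha (show -A ≤ -t by linarith)
    rwa [show -t - -A = A - t by ring] at h
  have h3 : g.edist hg (riemannianExpMap g y (t • b)) (riemannianExpMap g y (B • b)) ≤
      ENNReal.ofReal (B - t) := by
    rw [riemannianExpMap_eq, expMap_smul hc, expMap_smul hc]
    exact edist_maximalGeodesic_le hg hc y hb htB
  calc g.edist hg (riemannianExpMap g y ((-A) • a)) (riemannianExpMap g y (B • b))
      ≤ g.edist hg (riemannianExpMap g y ((-A) • a)) (riemannianExpMap g y (t • b)) +
          g.edist hg (riemannianExpMap g y (t • b)) (riemannianExpMap g y (B • b)) :=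
        g.edist_triangle hg _ _ _
    _ ≤ (g.edist hg (riemannianExpMap g y ((-A) • a)) (riemannianExpMap g y ((-t) • a)) +
          g.edist hg (riemannianExpMap g y ((-t) • a)) (riemannianExpMap g y (t • b))) +
          g.edist hg (riemannianExpMap g y (t • b)) (riemannianExpMap g y (B • b)) := by
        gcongr
        exact g.edist_triangle hg _ _ _
    _ ≤ (ENNReal.ofReal (A - t) +
          g.edist hg (riemannianExpMap g y ((-t) • a)) (riemannianExpMap g y (t • b))) +
          ENNReal.ofReal (B - t) := by
        gcongr
    _ < (ENNReal.ofReal (A - t) + ENNReal.ofReal (2 * t)) + ENNReal.ofReal (B - t) :=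
        ENNReal.add_lt_add_right ENNReal.ofReal_ne_top
          (ENNReal.add_lt_add_left ENNReal.ofReal_ne_top hmid)
    _ = ENNReal.ofReal (A + B) := by
        rw [← ENNReal.ofReal_add (by linarith) (by linarith),
          ← ENNReal.ofReal_add (by linarith) (by linarith)]
        congr 1
        ring

/-! ### Prolongation of minimizing segments -/

/-- **Prolongation lemma.** Let `γ_v|[0,1]` be minimizing, `v ≠ 0`, `q = exp_p v`, and let `r`
lie behind `q` as seen from `p`: `d(p,r) = d(p,q) + d(q,r)`. Then `r = γ_v(s)` for some `s ≥ 1`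
with `γ_v|[0,s]` minimizing. Proof: if `r ≠ q`, join `q` to `r` by a minimizing `γ_w|[0,1]`
(Hopf–Rinow); if the unit vectors `γ_v'(1)/|v|` and `w/|w|` differed, the strict triangle
inequality at the corner `q` (`edist_expMap_neg_smul_expMap_smul_lt`) would give
`d(p,r) < |v| + |w| = d(p,q) + d(q,r)`; so `w = (|w|/|v|) γ_v'(1)`, `γ_w` continues `γ_v`
(`expMap_smul_velocity_one`), `r = γ_v(1 + |w|/|v|)` and `L(γ_v|[0,s]) = |v| + |w| = d(p,r)`.
[cite: LeeRiemannianManifolds2018, Prop. 10.32 (a) (proof)] -/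
theorem exists_isMinimizingUpTo_of_edist_eq_add [ConnectedSpace M] (hn : (∞ : ℕ∞ω) ≤ n)
    (hg : g.IsRiemannian) (hc : IsGeodesicallyComplete g.leviCivita) {p : M}
    {v : TangentSpace I p} (hv0 : v ≠ 0) (hmin : IsMinimizingUpTo g hg p v 1) {r : M}
    (hr : g.edist hg p r =
      g.edist hg p (riemannianExpMap g p v) + g.edist hg (riemannianExpMap g p v) r) :
    ∃ s : ℝ, 1 ≤ s ∧ IsMinimizingUpTo g hg p v s ∧ maximalGeodesic g.leviCivita p v s = r := by
  haveI := fact_one_le_of_infty_le hn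
  haveI : LocallyCompactSpace M := Manifold.locallyCompact_of_finiteDimensional (M := M) I
  obtain ⟨ℓ, hℓ⟩ : ∃ ℓ : ℝ, ℓ = Real.sqrt (g.val p v v) := ⟨_, rfl⟩
  have hℓpos : 0 < ℓ := by
    rw [hℓ]
    exact Real.sqrt_pos.2 (hg p v hv0)
  have hℓsq : ℓ ^ 2 = g.val p v v := by
    rw [hℓ, Real.sq_sqrt (hg p v hv0).le]
  have hdom := (maximalGeodesic_of_isGeodesicallyComplete hc p v).1
  have hq1 : riemannianExpMap g p v = maximalGeodesic g.leviCivita p v 1 :=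
    expMap_eq_maximalGeodesic hc p v
  have hdpq : g.edist hg p (maximalGeodesic g.leviCivita p v 1) = ENNReal.ofReal ℓ := by
    rw [← hq1, hℓ]
    exact edist_eq_of_isMinimizingUpTo hg hc hmin
  rw [hq1] at hr
  by_cases hrq : r = maximalGeodesic g.leviCivita p v 1
  · exact ⟨1, le_rfl, hmin, hrq.symm⟩
  -- a minimizing segment from `q = γ_v(1)` to `r`
  obtain ⟨w, hwmin, hwr⟩ := exists_isMinimizingUpTo_of_isGeodesicallyComplete (g := g) hn hg hc
    (maximalGeodesic g.leviCivita p v 1) r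
  obtain ⟨m, hm⟩ : ∃ m : ℝ, m = Real.sqrt (g.val (maximalGeodesic g.leviCivita p v 1) w w) :=
    ⟨_, rfl⟩
  have hdqr : g.edist hg (maximalGeodesic g.leviCivita p v 1) r = ENNReal.ofReal m := by
    rw [← hwr, hm]
    exact edist_eq_of_isMinimizingUpTo hg hc hwmin
  have hm0 : 0 ≤ m := by
    rw [hm]
    exact Real.sqrt_nonneg _
  have hmpos : 0 < m := by
    rcases hm0.eq_or_lt with h0 | h0
    · exfalso
      apply hrq
      have h : g.edist hg (maximalGeodesic g.leviCivita p v 1) r = 0 := by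
        rw [hdqr, ← h0, ENNReal.ofReal_zero]
      exact ((g.edist_eq_zero_iff hg).1 h).symm
    · exact h0
  have hw0 : w ≠ 0 := by
    rintro rfl
    rw [hm] at hmpos
    simp at hmpos
  have hmsq : m ^ 2 = g.val (maximalGeodesic g.leviCivita p v 1) w w := by
    rw [hm, Real.sq_sqrt (hg _ w hw0).le]
  have hdpr : g.edist hg p r = ENNReal.ofReal (ℓ + m) := by
    rw [hr, hdpq, hdqr, ENNReal.ofReal_add hℓpos.le hm0]
  obtain ⟨u, hu⟩ : ∃ u : TangentSpace I (maximalGeodesic g.leviCivita p v 1),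
      u = velocity I (maximalGeodesic g.leviCivita p v) 1 := ⟨_, rfl⟩
  have huu : g.val (maximalGeodesic g.leviCivita p v 1) u u = ℓ ^ 2 := by
    rw [hu, val_velocity_maximalGeodesic hc p v 1, hℓsq]
  have hû1 : g.val (maximalGeodesic g.leviCivita p v 1) (ℓ⁻¹ • u) (ℓ⁻¹ • u) = 1 := by
    simp only [map_smul, _root_.smul_apply, smul_eq_mul, huu]
    field_simp
  have hŵ1 : g.val (maximalGeodesic g.leviCivita p v 1) (m⁻¹ • w) (m⁻¹ • w) = 1 := by
    simp only [map_smul, _root_.smul_apply, smul_eq_mul, ← hmsq]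
    field_simp
  by_cases huw : (ℓ⁻¹ • u : TangentSpace I (maximalGeodesic g.leviCivita p v 1)) = m⁻¹ • w
  · -- `w` continues `γ_v`
    have hw : w = (m * ℓ⁻¹) • u := by
      calc w = m • m⁻¹ • w := (smul_inv_smul₀ hmpos.ne' w).symm
        _ = m • ℓ⁻¹ • u := by rw [huw]
        _ = (m * ℓ⁻¹) • u := smul_smul m ℓ⁻¹ u
    have hrγ : r = maximalGeodesic g.leviCivita p v (m * ℓ⁻¹ + 1) := by
      rw [← hwr, hw, hu, expMap_smul_velocity_one hc p v]
    have hpos : 0 < m * ℓ⁻¹ := by positivity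
    refine ⟨m * ℓ⁻¹ + 1, by linarith, ⟨by rw [hdom]; exact subset_univ _, ?_⟩, hrγ.symm⟩
    rw [length_maximalGeodesic hg hc p v 0 (m * ℓ⁻¹ + 1), ← hℓ, ← hrγ, hdpr, sub_zero]
    congr 1
    field_simp
    ring
  · -- a genuine corner at `q`: impossible
    exfalso
    have hlt := edist_expMap_neg_smul_expMap_smul_lt hn hg hc
      (maximalGeodesic g.leviCivita p v 1) hû1 hŵ1 huw hℓpos hmpos
    have ha : riemannianExpMap g (maximalGeodesic g.leviCivita p v 1) ((-ℓ) • ℓ⁻¹ • u) = p := by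
      rw [smul_smul, hu, expMap_smul_velocity_one hc p v,
        show -ℓ * ℓ⁻¹ + 1 = (0 : ℝ) by rw [neg_mul, mul_inv_cancel₀ hℓpos.ne']; ring]
      exact (maximalGeodesic_of_isGeodesicallyComplete hc p v).2.2.1
    have hb : riemannianExpMap g (maximalGeodesic g.leviCivita p v 1) (m • m⁻¹ • w) = r := by
      rw [smul_inv_smul₀ hmpos.ne', hwr]
    rw [ha, hb, hdpr] at hlt
    exact lt_irrefl _ hlt

/-! ### Two minimizing segments to the same point -/

/-- **Two distinct minimizing geodesic segments from `p` to `q` make `q` a cut point along each**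
(Lee 2018, Prop. 10.32 and proof of Thm. 10.34 (c); Buchner 1977, p. 118: "or there are at least
two length minimizing geodesics from `p` to `x`"). If `v ≠ w`, `γ_v|[0,1]` and `γ_w|[0,1]` are
minimizing and `exp_p w = exp_p v`, then `v ∈ TCL(p)`. Proof: `|v| = |w| = d(p,q) > 0`; the
velocities `γ_w'(1) ≠ γ_v'(1)` (else `γ_w = γ_v` by uniqueness of geodesics and `w = v`); if
`γ_v|[0,s]` were minimizing for some `s > 1`, the broken geodesic `γ_w|[0,1] ∗ γ_v|[1,s]` from `p`
to `γ_v(s)` would have length `s|v| = d(p, γ_v(s))` although it has a genuine corner at `q`,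
contradicting `edist_expMap_neg_smul_expMap_smul_lt`.
[cite: LeeRiemannianManifolds2018, Prop. 10.32 and Thm. 10.34 (c) (proof)] -/
theorem mem_tangentCutLocus_of_ne (hn : (∞ : ℕ∞ω) ≤ n) (hg : g.IsRiemannian)
    (hc : IsGeodesicallyComplete g.leviCivita) {p : M} {v w : TangentSpace I p} (hvw : v ≠ w)
    (hv : IsMinimizingUpTo g hg p v 1) (hw : IsMinimizingUpTo g hg p w 1)
    (he : riemannianExpMap g p w = riemannianExpMap g p v) : v ∈ tangentCutLocus g hg p := by
  haveI := fact_one_le_of_infty_le hn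
  obtain ⟨ℓ, hℓ⟩ : ∃ ℓ : ℝ, ℓ = Real.sqrt (g.val p v v) := ⟨_, rfl⟩
  have hℓ0 : 0 ≤ ℓ := by
    rw [hℓ]
    exact Real.sqrt_nonneg _
  -- `|w| = |v| = d(p, q)`
  have hℓw : Real.sqrt (g.val p w w) = ℓ := by
    have h1 := edist_eq_of_isMinimizingUpTo hg hc hw
    rw [he, edist_eq_of_isMinimizingUpTo hg hc hv, ← hℓ] at h1
    exact ((ENNReal.ofReal_eq_ofReal_iff hℓ0 (Real.sqrt_nonneg _)).1 h1).symm
  -- hence both are non-zero (one of them is, as `v ≠ w`)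
  have hnorm0 : ∀ {x : TangentSpace I p}, Real.sqrt (g.val p x x) = 0 → x = 0 := by
    intro x hx
    by_contra hx0
    have h := hg p x hx0
    rw [Real.sqrt_eq_zero'] at hx
    exact absurd h (not_lt.2 hx)
  have hℓpos : 0 < ℓ := by
    rcases hℓ0.eq_or_lt with h0 | h0
    · exfalso
      apply hvw
      rw [hnorm0 (hℓ.symm.trans h0.symm), hnorm0 (hℓw.trans h0.symm)]
    · exact h0
  have hv0 : v ≠ 0 := by
    rintro rfl
    rw [hℓ] at hℓpos
    simp at hℓpos
  have hw0 : w ≠ 0 := by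
    rintro rfl
    rw [← hℓw] at hℓpos
    simp at hℓpos
  have hℓsq : ℓ ^ 2 = g.val p v v := by
    rw [hℓ, Real.sq_sqrt (hg p v hv0).le]
  have hℓsqw : ℓ ^ 2 = g.val p w w := by
    rw [← hℓw, Real.sq_sqrt (hg p w hw0).le]
  have hdom := (maximalGeodesic_of_isGeodesicallyComplete hc p v).1
  -- the common endpoint, seen from both geodesics
  have hy : maximalGeodesic g.leviCivita p w 1 = maximalGeodesic g.leviCivita p v 1 := by
    rw [← expMap_eq_maximalGeodesic hc p w, ← expMap_eq_maximalGeodesic hc p v]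
    exact he
  obtain ⟨u, hu⟩ : ∃ u : TangentSpace I (maximalGeodesic g.leviCivita p v 1),
      u = velocity I (maximalGeodesic g.leviCivita p v) 1 := ⟨_, rfl⟩
  obtain ⟨u', hu'⟩ : ∃ u' : TangentSpace I (maximalGeodesic g.leviCivita p v 1),
      u' = velocity I (maximalGeodesic g.leviCivita p w) 1 := ⟨_, rfl⟩
  have huu : g.val (maximalGeodesic g.leviCivita p v 1) u u = ℓ ^ 2 := by
    rw [hu, val_velocity_maximalGeodesic hc p v 1, hℓsq]
  -- facts about `γ_w` at time `1`, transported to the base point `γ_v(1)`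
  have hu'u' : g.val (maximalGeodesic g.leviCivita p v 1) u' u' = ℓ ^ 2 := by
    have key : ∀ y : M, maximalGeodesic g.leviCivita p w 1 = y →
        g.val y (velocity I (maximalGeodesic g.leviCivita p w) 1)
          (velocity I (maximalGeodesic g.leviCivita p w) 1) = g.val p w w := by
      rintro y rfl
      exact val_velocity_maximalGeodesic hc p w 1
    rw [hu', key _ hy, hℓsqw]
  have hexpu' : ∀ c : ℝ, riemannianExpMap g (maximalGeodesic g.leviCivita p v 1) (c • u') =
      maximalGeodesic g.leviCivita p w (c + 1) := by
    have key : ∀ y : M, maximalGeodesic g.leviCivita p w 1 = y → ∀ c : ℝ,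
        riemannianExpMap g y (c • velocity I (maximalGeodesic g.leviCivita p w) 1) =
          maximalGeodesic g.leviCivita p w (c + 1) := by
      rintro y rfl c
      exact expMap_smul_velocity_one hc p w c
    intro c
    rw [hu']
    exact key _ hy c
  -- the two directions at `q` differ
  have hne : (ℓ⁻¹ • u' : TangentSpace I (maximalGeodesic g.leviCivita p v 1)) ≠ ℓ⁻¹ • u := by
    intro h
    have h' : u' = u := by
      rw [← smul_inv_smul₀ hℓpos.ne' u', h, smul_inv_smul₀ hℓpos.ne']
    apply hvw
    have hgw := (maximalGeodesic_of_isGeodesicallyComplete hc p w).2.1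
    have hgv := (maximalGeodesic_of_isGeodesicallyComplete hc p v).2.1
    have hvel : velocity I (maximalGeodesic g.leviCivita p w) 1 =
        velocity I (maximalGeodesic g.leviCivita p v) 1 := by
      rw [← hu', ← hu]
      exact h'
    have hEq : EqOn (maximalGeodesic g.leviCivita p w) (maximalGeodesic g.leviCivita p v) univ :=
      IsGeodesicOn.eqOn_of_velocity_eq_holds (cov := g.leviCivita) isOpen_univ
        ordConnected_univ (hgw.isGeodesicOn univ) (hgv.isGeodesicOn univ) (mem_univ 1) hy hvel
    have hfun : maximalGeodesic g.leviCivita p w = maximalGeodesic g.leviCivita p v :=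
      funext fun t => hEq (mem_univ t)
    have h0w := (maximalGeodesic_of_isGeodesicallyComplete hc p w).2.2.2
    have h0v := (maximalGeodesic_of_isGeodesicallyComplete hc p v).2.2.2
    rw [hfun] at h0w
    exact h0v.symm.trans h0w
  -- suppose `γ_v` minimises on `[0, s]`, `s > 1`
  refine ⟨hv0, hv, fun s hs hmins => ?_⟩
  have hdpr : g.edist hg p (maximalGeodesic g.leviCivita p v s) = ENNReal.ofReal (s * ℓ) := by
    rw [← hmins.2, length_maximalGeodesic hg hc p v 0 s, sub_zero, ← hℓ]
  have ha1 : g.val (maximalGeodesic g.leviCivita p v 1) (ℓ⁻¹ • u') (ℓ⁻¹ • u') = 1 := by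
    simp only [map_smul, _root_.smul_apply, smul_eq_mul, hu'u']
    field_simp
  have hb1 : g.val (maximalGeodesic g.leviCivita p v 1) (ℓ⁻¹ • u) (ℓ⁻¹ • u) = 1 := by
    simp only [map_smul, _root_.smul_apply, smul_eq_mul, huu]
    field_simp
  have hBpos : 0 < (s - 1) * ℓ := mul_pos (by linarith) hℓpos
  have hlt := edist_expMap_neg_smul_expMap_smul_lt hn hg hc (maximalGeodesic g.leviCivita p v 1)
    ha1 hb1 hne hℓpos hBpos
  have hpa : riemannianExpMap g (maximalGeodesic g.leviCivita p v 1) ((-ℓ) • ℓ⁻¹ • u') = p := by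
    rw [smul_smul, hexpu',
      show -ℓ * ℓ⁻¹ + 1 = (0 : ℝ) by rw [neg_mul, mul_inv_cancel₀ hℓpos.ne']; ring]
    exact (maximalGeodesic_of_isGeodesicallyComplete hc p w).2.2.1
  have hrb : riemannianExpMap g (maximalGeodesic g.leviCivita p v 1) (((s - 1) * ℓ) • ℓ⁻¹ • u) =
      maximalGeodesic g.leviCivita p v s := by
    rw [smul_smul, hu, expMap_smul_velocity_one hc p v]
    congr 1
    field_simp
    ring
  rw [hpa, hrb, hdpr] at hlt
  have hsum : ℓ + (s - 1) * ℓ = s * ℓ := by ring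
  rw [hsum] at hlt
  exact lt_irrefl _ hlt

/-- **Two distinct minimizing geodesic segments from `p` to `q` make `q` a cut point** (metric
cut locus of `CutLocus.lean`), on a connected manifold: `mem_tangentCutLocus_of_ne` and
`expMap_mem_cutLocus_of_mem_tangentCutLocus`. This is the "two minimizing geodesics" half of the
characterisation of `C(p)` used by Buchner (p. 118).
[cite: Buchner1977Simplicial, p. 118 (characterisation of C(p), [6])] -/
theorem expMap_mem_cutLocus_of_ne [ConnectedSpace M] (hn : (∞ : ℕ∞ω) ≤ n) (hg : g.IsRiemannian)
    (hc : IsGeodesicallyComplete g.leviCivita) {p : M} {v w : TangentSpace I p} (hvw : v ≠ w)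
    (hv : IsMinimizingUpTo g hg p v 1) (hw : IsMinimizingUpTo g hg p w 1)
    (he : riemannianExpMap g p w = riemannianExpMap g p v) :
    riemannianExpMap g p v ∈ cutLocus g hg p :=
  expMap_mem_cutLocus_of_mem_tangentCutLocus hn hg hc (mem_tangentCutLocus_of_ne hn hg hc hvw hv hw he)

/-! ### Midpoints and the multiplicity of minimal geodesics -/

/-- **A midpoint lies halfway along a minimizing geodesic segment.** If `q ≠ p` and `m` is a
midpoint of `p, q` (`d(p,m) = d(m,q)` and `d(p,m) + d(m,q) = d(p,q)`), then there is `v ∈ T_pM`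
with `γ_v|[0,1]` minimizing, `exp_p v = q` and `exp_p(v/2) = m`: a minimizing segment `γ_a|[0,1]`
from `p` to `m` (Hopf–Rinow) prolongs minimally through `q = γ_a(s)`
(`exists_isMinimizingUpTo_of_edist_eq_add`), and `s|a| = d(p,q) = 2|a|` gives `s = 2`,
`v = 2a`. (The bijection "midpoints ↔ minimal geodesics" of the module docstring of
`CutLocus.lean`.) [folklore] -/
theorem exists_isMinimizingUpTo_of_midpoint [ConnectedSpace M] (hn : (∞ : ℕ∞ω) ≤ n)
    (hg : g.IsRiemannian) (hc : IsGeodesicallyComplete g.leviCivita) {p q m : M} (hqp : q ≠ p)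
    (h1 : g.edist hg p m = g.edist hg m q) (h2 : g.edist hg p m + g.edist hg m q = g.edist hg p q) :
    ∃ v : TangentSpace I p, IsMinimizingUpTo g hg p v 1 ∧ riemannianExpMap g p v = q ∧
      riemannianExpMap g p ((1 / 2 : ℝ) • v) = m := by
  haveI := fact_one_le_of_infty_le hn
  haveI : LocallyCompactSpace M := Manifold.locallyCompact_of_finiteDimensional (M := M) I
  obtain ⟨a, hamin, ham⟩ := exists_isMinimizingUpTo_of_isGeodesicallyComplete (g := g) hn hg hc p m
  obtain ⟨ℓ, hℓ⟩ : ∃ ℓ : ℝ, ℓ = Real.sqrt (g.val p a a) := ⟨_, rfl⟩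
  have hdpm : g.edist hg p m = ENNReal.ofReal ℓ := by
    rw [← ham, hℓ]
    exact edist_eq_of_isMinimizingUpTo hg hc hamin
  have ha0 : a ≠ 0 := by
    rintro rfl
    apply hqp
    have hm : m = p := by
      rw [← ham]
      exact riemannianExpMap_zero g p
    rw [hm, g.edist_self hg] at h1
    exact ((g.edist_eq_zero_iff hg).1 h1.symm).symm
  have hℓpos : 0 < ℓ := by
    rw [hℓ]
    exact Real.sqrt_pos.2 (hg p a ha0)
  have hr : g.edist hg p q =
      g.edist hg p (riemannianExpMap g p a) + g.edist hg (riemannianExpMap g p a) q := by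
    rw [ham]
    exact h2.symm
  obtain ⟨s, hs1, hmins, hsq⟩ := exists_isMinimizingUpTo_of_edist_eq_add hn hg hc ha0 hamin hr
  -- `s |a| = d(p, q) = 2 |a|`, so `s = 2`
  have hdpq : g.edist hg p q = ENNReal.ofReal (s * ℓ) := by
    rw [← hsq, ← hmins.2, length_maximalGeodesic hg hc p a 0 s, sub_zero, ← hℓ]
  have hdpq' : g.edist hg p q = ENNReal.ofReal (2 * ℓ) := by
    rw [← h2, ← h1, hdpm, ← ENNReal.ofReal_add hℓpos.le hℓpos.le, two_mul]
  have hs2 : s = 2 := by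
    have h : s * ℓ = 2 * ℓ := by
      have h' := hdpq.symm.trans hdpq'
      exact (ENNReal.ofReal_eq_ofReal_iff (by positivity) (by positivity)).1 h'
    exact mul_right_cancel₀ hℓpos.ne' h
  subst hs2
  refine ⟨(2 : ℝ) • a, ?_, ?_, ?_⟩
  · rw [isMinimizingUpTo_smul_iff hg hc p a two_pos 1, mul_one]
    exact hmins
  · rw [riemannianExpMap_eq, expMap_smul hc, hsq]
  · rw [smul_smul, show (1 / 2 : ℝ) * 2 = 1 by norm_num, one_smul, ham]

/-- **A point of minimal-geodesic multiplicity `≥ 2` is a cut point**, for a smooth Riemannian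
metric with geodesically complete Levi-Civita connection on a connected Hausdorff manifold without
boundary: two distinct midpoints `m₁ ≠ m₂` of `p, q` lie halfway along two minimizing segments
`γ_{v₁}|[0,1]`, `γ_{v₂}|[0,1]` from `p` to `q` (`exists_isMinimizingUpTo_of_midpoint`), which are
distinct (`exp_p(vᵢ/2) = mᵢ`), so `q ∈ cutLocus p` (`expMap_mem_cutLocus_of_ne`). This is the
classical fact "a point joined to `p` by two distinct minimal geodesics is the cut point along
each" (Lee 2018, Prop. 10.32; Bishop 1977, p. 133) in the midpoint vocabulary of `CutLocus.lean`
(for complete = proper-balls manifolds see `mem_cutLocus_of_two_le_minimalGeodesicMultiplicity`,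
`CutLocusMultiplicity.lean`). [cite: LeeRiemannianManifolds2018, Prop. 10.32 (a)] -/
theorem mem_cutLocus_of_two_le_minimalGeodesicMultiplicity_of_isGeodesicallyComplete
    [ConnectedSpace M] (hn : (∞ : ℕ∞ω) ≤ n) (hg : g.IsRiemannian)
    (hc : IsGeodesicallyComplete g.leviCivita) {p q : M}
    (h2 : 2 ≤ minimalGeodesicMultiplicity g hg p q) : q ∈ cutLocus g hg p := by
  haveI : LocallyCompactSpace M := Manifold.locallyCompact_of_finiteDimensional (M := M) I
  have hqp : q ≠ p := by
    rintro rfl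
    rw [minimalGeodesicMultiplicity_self hg q] at h2
    exact absurd h2 (by norm_num)
  rw [minimalGeodesicMultiplicity_eq_encard] at h2
  obtain ⟨m₁, m₂, hm₁, hm₂, hne⟩ :=
    Set.one_lt_encard_iff.1 (lt_of_lt_of_le (by exact_mod_cast Nat.one_lt_two) h2)
  obtain ⟨v₁, hv₁, hq₁, hm₁'⟩ := exists_isMinimizingUpTo_of_midpoint hn hg hc hqp hm₁.1 hm₁.2
  obtain ⟨v₂, hv₂, hq₂, hm₂'⟩ := exists_isMinimizingUpTo_of_midpoint hn hg hc hqp hm₂.1 hm₂.2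
  have hvne : v₁ ≠ v₂ := fun h => hne (by rw [← hm₁', ← hm₂', h])
  rw [← hq₁]
  exact expMap_mem_cutLocus_of_ne hn hg hc hvne hv₁ hv₂ (hq₂.trans hq₁.symm)

/-- On a **compact** connected manifold (smooth Riemannian metric) points of multiplicity `≥ 2`
are cut points (`hopfRinow_compact_geodesicallyComplete`). [cite: LeeRiemannianManifolds2018, Prop. 10.32 (a)] -/
theorem mem_cutLocus_of_two_le_minimalGeodesicMultiplicity_of_compactSpace [CompactSpace M]
    [ConnectedSpace M] (hn : (∞ : ℕ∞ω) ≤ n) (hg : g.IsRiemannian) {p q : M}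
    (h2 : 2 ≤ minimalGeodesicMultiplicity g hg p q) : q ∈ cutLocus g hg p :=
  mem_cutLocus_of_two_le_minimalGeodesicMultiplicity_of_isGeodesicallyComplete hn hg
    (hopfRinow_compact_geodesicallyComplete hn hg) h2

end Complete

end Literature.Geometry.Riemannian

end
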